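import Summits.RiemannHypothesis.RiemannHypothesis.Theses.RuelleBand
import Summits.RiemannHypothesis.RiemannHypothesis.Theorems.RuelleBandCofiniteCriticalLineStubCofiniteWeilCriterion
import Summits.RiemannHypothesis.RiemannHypothesis.Theorems.RuelleBandCofiniteCriticalLineStubDefinitize
import HarnessLib

/-!
# `CofiniteCriticalLine` from a bounded Weil index, modulo Kreĭn's definitization theorem

Crux `Summit.RiemannHypothesis.RiemannHypothesis.Theses.RuelleBand.CofiniteCriticalLine` (item
stmt-RiemannHypothesis-2064: all but finitely many non-trivial zeros of `ζ` lie on the critical line),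
line `cofinite-weil-index-staircase` (lead prover-line-stmt-RiemannHypothesis-2064-0, 2026-08-16).

This file records the CLOSED LOWER HALF of the line as one citable conditional rung, shared with every
Weil-index line of the crux (`weil-inertia-pontryagin-index`, `pontryagin-neutral-engine`, whose bet is
exactly the hypothesis `hB` below):

  `BoundedWeilIndex ∧ KreinDefinitization ⟹ CofiniteCriticalLine`,

where `BoundedWeilIndex` is "there is `N` such that, on every window `[-a, a]`, no `(N+1)`-tuple of test
functions spans a subspace on which `Re Q` (`Q = weilQuadratic`) is negative definite" and
`Literature.Analysis.OperatorTheory.KreinDefinitization` is Kreĭn's 1959 definitization theorem for smooth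
Hermitian functions with finitely many negative squares (an unproved named Literature fact; the result is
therefore CONDITIONAL on it). The proof is the composition of the two landed stubs
`stub_definitize_of_krein` (translation kernels `x ↦ Q(f_x, f)` have `≤ N` negative squares, Kreĭn
definitizes them by `p(-D)`, zero-side dictionary) and `stub_cofiniteWeilCriterion` (the converse Weil
criterion inside one translation orbit: `2D + 1` off-line zeros against `≤ 2D` roots of `p`).
The UPPER half of the line (`END ⟹ BoundedWeilIndex`, stubs `stub_branchesContinuous`,
`stub_zeroLevelWindow`, `stub_zeroLevelNullVector`, `stub_windowIndexFinite`, all landed) cannot yet be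
assembled in one module because of a duplicate declaration of
`Literature.NumberTheory.LFunctions.WeilWindowSimpleEven` in the tree (see the crux `NOTES.md`).
-/

set_option linter.dupNamespace false

noncomputable section

open Complex MeasureTheory Filter Set
open scoped BigOperators Topology ComplexConjugate

namespace Summit.RiemannHypothesis.RiemannHypothesis.Theorems.RuelleBandCofiniteCriticalLine

open Literature.NumberTheory.LFunctions

/-- **Bounded Weil index ⟹ `CofiniteCriticalLine`, modulo Kreĭn's definitization theorem.**  If Weil's
quadratic form `Re Q`, `Q = weilQuadratic`, has a UNIFORM bound `N` on its negative index over all windows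
(`hB`: on every window every `(N+1)`-tuple of test functions has a non-zero combination with `Re Q ≥ 0`),
and Kreĭn's definitization theorem `KreinDefinitization` holds, then all but finitely many non-trivial
zeros of `ζ` lie on the critical line.  Composition of the landed `stub_definitize_of_krein` and
`stub_cofiniteWeilCriterion`; CONDITIONAL on the named fact `KreinDefinitization`. [folklore] -/
theorem cofiniteCriticalLine_of_boundedWeilIndex_of_krein :
    Literature.Analysis.OperatorTheory.KreinDefinitization →
    (∃ N : ℕ, ∀ a : ℝ, ∀ g : Fin (N + 1) → ℝ → ℂ, (∀ i, IsWeilTest (g i)) →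
        (∀ i, tsupport (g i) ⊆ Set.Icc (-a) a) →
        ∃ c : Fin (N + 1) → ℂ, c ≠ 0 ∧ 0 ≤ (weilQuadratic (fun t => ∑ i, c i * g i t)).re) →
    Summit.RiemannHypothesis.RiemannHypothesis.Theses.RuelleBand.CofiniteCriticalLine :=
  fun hK hB => stub_cofiniteWeilCriterion (stub_definitize_of_krein hK hB)

/-- The same with the window-free bounded-index hypothesis of the sibling lines
(`BoundedWeilIndex := ∃ N, ∀ (N+1)-tuple of tests, ∃ c ≠ 0, 0 ≤ Re Q(∑ cᵢ gᵢ)`; every tuple lives in some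
window, so the two hypotheses are trivially equivalent — here only the easy direction is needed). [folklore] -/
theorem cofiniteCriticalLine_of_boundedWeilIndex_of_krein'
    (hK : Literature.Analysis.OperatorTheory.KreinDefinitization)
    (hB : ∃ N : ℕ, ∀ g : Fin (N + 1) → ℝ → ℂ, (∀ i, IsWeilTest (g i)) →
        ∃ c : Fin (N + 1) → ℂ, c ≠ 0 ∧ 0 ≤ (weilQuadratic (fun t => ∑ i, c i * g i t)).re) :
    Summit.RiemannHypothesis.RiemannHypothesis.Theses.RuelleBand.CofiniteCriticalLine := by
  obtain ⟨N, hN⟩ := hB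
  exact cofiniteCriticalLine_of_boundedWeilIndex_of_krein hK ⟨N, fun _ g hg _ => hN g hg⟩

end Summit.RiemannHypothesis.RiemannHypothesis.Theorems.RuelleBandCofiniteCriticalLine

end
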